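import Summits.QuantumFields.YangMills.Theorems.UnitScaleTiltProp7CombAccFrameMassStep
import Summits.QuantumFields.YangMills.Theorems.UnitScaleTiltProp7CombTowerRowsOfRegPrT3
import Summits.QuantumFields.YangMills.Theorems.UnitScaleTiltProp7TwistedLevelMassInduction
import HarnessLib

/-!
# Route `UnitScaleTilt`, crux K1 «MinimiserStabilityRegPr» (stmt-QuantumFields-19200), route-R E′ (A′)-on-Σ, P-A2-COMB (β), item «F3″-COMB» (★★OWNER RULING №19), file F3b —
# THE `ℓ²` MASS OF PRINT's COMB ACCUMULATED FRAMES AT THE MEMBER, UNDER THE DISPLAYED ROW `hMcomb`: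
# `Σ_{y} ‖w_{iX}(y) − 1‖² ≤ 220L³·Am·ℓ⁻¹ + 110L²·Bm·ℓ` for `W ∈ 𝔘_k(ε₀)`, `X` of (19)-size `< ε₀∕6`, whenever the single-bar level masses of print's comb tower obey
# `Mᶜ_l ≤ Am·L^{−l} + Bm·Lˡ` (`l < k = K − n`) — «route-internal row (n3)-comb — NOT N06, NOT a print row; OPEN, XL, LOCATE #54»

Cell `ym3-torus`, extra width seat `ym-routeR-w6` (gen 8); LOCATE `LOCATE-F3COMB-routeRw6g8.md` (19200 evidence #54); ★★OWNER RULING №19 (05:13Z) O1 + O4.  THEOREMS ONLY (0 `def`,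
0 `sorry`); `--supports stmt-QuantumFields-19200 --as helper`, count-neutral; CONDITIONAL on the displayed hypothesis `hMcomb` (no supplier in the tree, see the LOCATE).  YM₃ on T³ is a
ladder rung (R3), not the Clay problem; nothing here claims the stub, the crux, (β), `hPA2`, `hcoS`, d = 4 or the mass gap.

THE POINT.  The comb accumulated frame of the route's twisted chart is print's (97) frame on the based pullbacks: `frameTw F n K h W A y = vcov L (W♭)♯ (e^{A})♯ (K − n) (coordT3 y)`
(★w5 ✓ `Prop7SymAvgTwFrameDiff.frameTw_eq_vcov`).  File F2 (✓ `Prop7CombAccFrameMassStep.combFrameMass_step_le`) is the one-step `ℓ²` inequality for `vcov` over one period cell with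
every input displayed; here the inputs are supplied at a printed-regular background `W ∈ 𝔘_k(ε₀)` for a Hermitian traceless `X` of (19)-size `nMax19 W X < ε₀∕6` (the letters of
✓ `Prop7FrameResponseCombSU2.frameTw_I_smul_mem_specialUnitaryGroup_of_nMax19_lt`): unitarity of the comb towers and frames and the sup rows (163) `‖v_l − 1‖ ≤ 64dLˡb`, `‖Ũ₁ˡ − 1‖ ≤ 130dLˡb`
(`Lᵏb = ε₀∕6`) from lit-balaban ✓ `B8Prop7AdmittedFamily` through (1.139) (✓ `inAk_pull_of_regPr`∕`pdev_pull_lt`) and (1.141) (✓ `pdev_pull_emb15_le_of_regPr_of_nMax19`); the tree-ratio row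
`‖(R_{0,L•ẑ}Ũ₁ˡ)(Γ_r) − 1‖ ≤ 6L·√Bᶜ_l(z)` from LOCALITY of the tree transport to the cornered box (lit ✓ `B7LocalityGeneral.tHol_treeWord_congr`) and the walk bound (lit
✓ `B7Prop7OneStep.norm_tHol_sub_one_le_general`), `Bᶜ_l(z)` the box mass of `Ũ₁ˡ − 1`, `Σ_z Bᶜ_l(z) = Mᶜ_l`; then ✓px22∕px17's pure-real induction ✓ `Prop7TwistedLevelMassInduction.frameMass_induction`
(`q = 3(L⁻³ + 144t*²)`, `qL ≤ ½`; `C = 3(1+6t*)²·36L² ≤ 110L²`) and the re-indexing `coordT3 y = (siteShift y)^` along lit `T3LevelShift.siteShift`.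

WHAT IS PROVED (ns `…Theorems.Prop7CombAccFrameMassOfRegPr`; T³, `SU(2)`).
* (letters in file F3a ✓ `Prop7CombTowerRowsOfRegPr`: the box walk bound, `member_windows` at `10⁷L⁴ε₀ ≤ 1`, the per-level comb-tower rows `comb_level_rows_of_regPr`.)
* §3 ★★ `combFrameMass_recursion_of_regPr` — `Φᶜ_{l+1} ≤ q·Φᶜ_l + 110L²·Mᶜ_l` for `l < K − n`, with `Φᶜ_0 = 0`.
* §4 ★★★ `sum_normSq_frameTw_sub_one_le_of_hMcomb` — the title (both `w − 1` and `w⁻¹ − 1`), `hMcomb` displayed TOKEN FOR TOKEN as in the bus SIGNATURE-0 (05:15Z) at `A := fun b ↦ I•X b`.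
HONEST SCOPE.  Bookkeeping over lit-balaban's certified tower rows and files F1∕F2; the one analytic input with no supplier — the single-bar `ℓ²` level masses of PRINT's comb tower in the split
currency — is DISPLAYED (`hMcomb`); nothing of print is asserted; (β), `hPA2`, `hcoS`, E′, EX and the crux are NOT advanced beyond this conditional row.

References: T. Bałaban, CMP 98 (1985) 17–51 [Balaban1985Averaging] ((58)–(60) p.27, (69) p.29, (82) p.30, (85)–(92) p.31, (97)–(99) p.32, Prop. 3 (122)–(126) p.36, (159)–(163) p.42);
CMP 99 (1985) 75–102 [Balaban1985RegularSpaces] (Prop. 7 (1.139)–(1.145) p.100); CMP 102 (1985) 277–309 [Balaban1985Variational] ((2) p.278, (19) p.281, (44) p.285); CMP 109 (1987)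
249–301 [Balaban1987RG1] ((0.3)–(0.4) pp.252–253).
-/

set_option autoImplicit false

noncomputable section

open scoped BigOperators Matrix.Norms.L2Operator

namespace Summit.QuantumFields.YangMills.Theorems.Prop7CombAccFrameMassOfRegPr

open Finset NormedSpace
open Literature.MathematicalPhysics.QuantumFieldTheory.Balaban1983to89
open Literature.MathematicalPhysics.QuantumFieldTheory.Balaban1983to89.T3ContinuumYM3Torus
open T4Continuum BlockAveraging
open T3PrintedRegularMinimiser (RegPr)
open T3SectALandauChart (eta eta_pos bgUnits emb15)
open T3LevelShift (siteShift)
open T3PrintedRegularOrbits (sites_eq)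
open B7Prop1Explicit renaming Site → LSite
open B7Prop1Explicit (e hol disp treeWord disp_treeWord boxVec expUnit U1 mem_U1 l1 length_treeWord l1_boxVec_le)
open B7Prop1Local (InBox AgreeOn)
open B7Prop2Explicit (avgIter pdev C0 c2' unitaryUnits unitaryUnits_le_U1 hol_mem_of)
open B7Prop2SpecialUnitary (specialUnitaryUnits mem_specialUnitaryUnits specialUnitaryUnits_le_unitaryUnits)
open B7Prop3Flat (expCfg c3)
open B7Eq92Concrete (Rc Rc_apply tHol tildIter dbavgCovIter vcov vcov_zero)
open B10Eq27TorusAxialLog (pull pull_apply transl unitsField toUField)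
open Summit.QuantumFields.YangMills.Theorems.Prop7SPrint (basePt)
open Summit.QuantumFields.YangMills.Theorems.Prop7TPrint (nMax19 nMax19_lt_iff expHermField expHermField_apply coe_expHerm)
open Summit.QuantumFields.YangMills.Theorems.Prop7AxialReprPrint (pull_toUField_mem inAk_pull_of_regPr pdev_pull_lt)
open Summit.QuantumFields.YangMills.Theorems.Prop7SymAvgGLSmallOfRegPr (bgUnits_eq)
open Summit.QuantumFields.YangMills.Theorems.Prop7SymAvgTw (coordT3 frameTw)
open Summit.QuantumFields.YangMills.Theorems.Prop7SymAvgTwFrameDiff (frameTw_eq_vcov pull_expUnit_eq_expCfg)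
open Summit.QuantumFields.YangMills.Theorems.Prop7ChartSigmaT3 (pull_emb15)
open Summit.QuantumFields.YangMills.Theorems.Prop7ChartSigmaT3GlevSU (pull_eq_expCfg_of_exp)
open Summit.QuantumFields.YangMills.Theorems.Prop7ChartSigmaT3OfRegPr (pdev_pull_emb15_le_of_regPr_of_nMax19)
open Summit.QuantumFields.YangMills.Theorems.Prop7SPrintIn19 (pow_mul_eta)
open Summit.QuantumFields.YangMills.Theorems.Prop7SymFrameBound (coe_expUnit_I_smul_mem_specialUnitaryGroup)
open Summit.QuantumFields.YangMills.Theorems.Prop7FrameResponseCombSU2 (windows_of_ten7 tower_windows_of_ten7)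
open Summit.QuantumFields.YangMills.Theorems.Prop7TwistedLevelMassInduction (frameMass_induction)
open Summit.QuantumFields.YangMills.Theorems.Prop7CombAccFrameMassStep (valLift_blockSite sum_blockLift_eq le_sqrt_sum_sq combFrameMass_step_le)
open B11Eq98V0LettersFlat (norm_inv_sub_one_le)

open Summit.QuantumFields.YangMills.Theorems.Prop7CombTowerRowsOfRegPr (norm_tHol_treeWord_sub_one_le_of_box member_windows comb_level_rows_of_regPr)

section Member

variable (F : T3Family) {n K : ℕ} (h : n ≤ K)

/-! ## §3 ★★ The comb frame-mass recursion at the member -/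

/-- ★★ **THE COMB ACCUMULATED-FRAME MASS RECURSION AT A PRINTED-REGULAR BACKGROUND**: with `Φᶜ_l := Σ_{x : Site (F.P K) l} ‖v_l(x̂) − 1‖²` (`v_l = vcov L (W♭)♯ (e^{iX})♯ l`) and
`Mᶜ_l := Σ_{x} Σ_κ ‖Ũ₁ˡ(x̂, κ) − 1‖²` (the single-bar level mass of print's comb tower — the `hMcomb` object), for every `l < K − n`:
`Φᶜ_{l+1} ≤ 3(L⁻³ + 144t*²)·Φᶜ_l + 110L²·Mᶜ_l`, `t* = 780L³ε₀ + 96ε₀` (file F2 with §2's rows; the tree-ratio row by §1 at the box mass, `C_R = 6L`).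
[cite: Balaban1985Averaging, (82) p.30, (85) p.31, (97) p.32, (159)-(163) p.42; Balaban1987RG1, (0.3)-(0.4) pp.252-253] -/
theorem combFrameMass_recursion_of_regPr {ε₀ : ℝ} (hε₀ : 0 < ε₀) (hε : 10 ^ 7 * (F.L : ℝ) ^ 4 * ε₀ ≤ 1)
    (W : GaugeField (F.P K) 0 (Matrix.specialUnitaryGroup (Fin 2) ℂ)) (hreg : RegPr F n K ε₀ W)
    (X : PBond (F.P K) 0 → Matrix (Fin 2) (Fin 2) ℂ) (hX : ∀ b, (X b).IsHermitian ∧ (X b).trace = 0) (hX6 : nMax19 F n K W X < ε₀ / 6)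
    {l : ℕ} (hl : l < K - n) :
    ∑ z : Site (F.P K) (l + 1), ‖((vcov (F.P K).L (pull (bgUnits F K W) (basePt F n K)) (expCfg fun z κ => Complex.I • X ⟨transl (basePt F n K) z, κ⟩) (l + 1)
          (fun μ => ((z μ).val : ℤ)) : (Matrix (Fin 2) (Fin 2) ℂ)ˣ) : Matrix (Fin 2) (Fin 2) ℂ) - 1‖ ^ 2
      ≤ 3 * (((F.L : ℝ) ^ 3)⁻¹ + 144 * (780 * (F.L : ℝ) ^ 3 * ε₀ + 3 * (32 * ε₀)) ^ 2)
          * ∑ x : Site (F.P K) l, ‖((vcov (F.P K).L (pull (bgUnits F K W) (basePt F n K)) (expCfg fun z κ => Complex.I • X ⟨transl (basePt F n K) z, κ⟩) l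
              (fun μ => ((x μ).val : ℤ)) : (Matrix (Fin 2) (Fin 2) ℂ)ˣ) : Matrix (Fin 2) (Fin 2) ℂ) - 1‖ ^ 2
        + 110 * (F.L : ℝ) ^ 2
          * ∑ x : Site (F.P K) l, ∑ κ : Fin (F.P K).d, ‖((tildIter (F.P K).L (pull (bgUnits F K W) (basePt F n K)) (expCfg fun z κ => Complex.I • X ⟨transl (basePt F n K) z, κ⟩) l
              (fun μ => ((x μ).val : ℤ)) κ : (Matrix (Fin 2) (Fin 2) ℂ)ˣ) : Matrix (Fin 2) (Fin 2) ℂ) - 1‖ ^ 2 := by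
  letI : CStarAlgebra (Matrix (Fin 2) (Fin 2) ℂ) := B10Eq29TubeLine.cstarAlgebraMatrix 2
  have hL3 : (3 : ℝ) ≤ F.L := by
    have h3 : 3 ≤ F.L := by obtain ⟨a, ha⟩ := F.hL.1; have := F.hL.2; omega
    exact_mod_cast h3
  have hL0 : (0 : ℝ) < F.L := by linarith
  have hL1 : (1 : ℝ) ≤ (F.L : ℝ) ^ 4 := one_le_pow₀ (by linarith)
  have hε3 : 10 ^ 7 * (F.L : ℝ) ^ 3 * ε₀ ≤ 1 := by
    have h34 : (F.L : ℝ) ^ 3 ≤ (F.L : ℝ) ^ 4 := pow_le_pow_right₀ (by linarith) (by norm_num)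
    nlinarith [h34, hε₀.le]
  have hd3 : (F.P K).d = 3 := T3Family.P_d F K
  have hPL : (((F.P K).L : ℕ) : ℝ) = (F.L : ℝ) := rfl
  have hLd : (((F.P K).L : ℝ) ^ (F.P K).d) = (F.L : ℝ) ^ 3 := by rw [hd3]; rfl
  have hlm : l + 1 ≤ (F.P K).m + (F.P K).K := by
    show l + 1 ≤ F.m + K
    have := F.hm; omega
  obtain ⟨hw1, hw2, hw3, -, hw5⟩ := member_windows F hε₀.le hε
  -- §2's rows at level `l`
  obtain ⟨hA, -, hVu, hV2, hT, hTu⟩ := comb_level_rows_of_regPr F hε₀ hε3 W hreg X hX hX6 l hl.le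
  -- letters
  set U₀' := pull (bgUnits F K W) (basePt F n K) with hU₀'
  set B' : LSite (F.P K).d → Fin (F.P K).d → Matrix (Fin 2) (Fin 2) ℂ := fun z κ => Complex.I • X ⟨transl (basePt F n K) z, κ⟩ with hB'
  -- the box mass of `Ũ₁ˡ − 1`
  set Bl : Site (F.P K) (l + 1) → ℝ := fun z => ∑ r' : Fin (F.P K).d → Fin (F.P K).L, ∑ κ : Fin (F.P K).d,
    ‖((tildIter (F.P K).L U₀' (expCfg B') l (((F.P K).L : ℤ) • (fun μ => ((z μ).val : ℤ)) + boxVec (F.P K).L r') κ : (Matrix (Fin 2) (Fin 2) ℂ)ˣ) : Matrix (Fin 2) (Fin 2) ℂ) - 1‖ ^ 2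
    with hBl
  have hBl0 : ∀ z, 0 ≤ Bl z := fun z => Finset.sum_nonneg fun _ _ => Finset.sum_nonneg fun _ _ => sq_nonneg _
  -- `√Bl ≤ 2L²·65ε₀`
  have hsqrtBl : ∀ z, Real.sqrt (Bl z) ≤ 2 * (F.L : ℝ) ^ 2 * (65 * ε₀) := by
    intro z
    have hterm : Bl z ≤ ∑ _r' : Fin (F.P K).d → Fin (F.P K).L, ∑ _κ : Fin (F.P K).d, (65 * ε₀) ^ 2 := by
      refine Finset.sum_le_sum fun r' _ => Finset.sum_le_sum fun κ _ => ?_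
      exact pow_le_pow_left₀ (norm_nonneg _) (hT _ _) 2
    have hcount : (∑ _r' : Fin (F.P K).d → Fin (F.P K).L, ∑ _κ : Fin (F.P K).d, (65 * ε₀) ^ 2 : ℝ) = 3 * (F.L : ℝ) ^ 3 * (65 * ε₀) ^ 2 := by
      simp only [Finset.sum_const, Finset.card_univ, Fintype.card_fun, Fintype.card_fin, nsmul_eq_mul, hd3]
      push_cast
      rw [hPL]
      ring
    rw [hcount] at hterm
    calc Real.sqrt (Bl z) ≤ Real.sqrt (3 * (F.L : ℝ) ^ 3 * (65 * ε₀) ^ 2) := Real.sqrt_le_sqrt hterm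
      _ = Real.sqrt (3 * (F.L : ℝ) ^ 3) * (65 * ε₀) := by
          rw [Real.sqrt_mul (by positivity), Real.sqrt_sq (by positivity)]
      _ ≤ 2 * (F.L : ℝ) ^ 2 * (65 * ε₀) := mul_le_mul_of_nonneg_right hw3 (by positivity)
  -- the U1 readings
  have hU1hol : ∀ (z : Site (F.P K) (l + 1)) (r : Fin (F.P K).d → Fin (F.P K).L),
      ‖((hol (avgIter (F.P K).L U₀' l) (((F.P K).L : ℤ) • (fun μ => ((z μ).val : ℤ))) (treeWord (boxVec (F.P K).L r)) : (Matrix (Fin 2) (Fin 2) ℂ)ˣ) : Matrix (Fin 2) (Fin 2) ℂ)‖ ≤ 1 ∧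
        ‖(((hol (avgIter (F.P K).L U₀' l) (((F.P K).L : ℤ) • (fun μ => ((z μ).val : ℤ))) (treeWord (boxVec (F.P K).L r)))⁻¹ : (Matrix (Fin 2) (Fin 2) ℂ)ˣ) : Matrix (Fin 2) (Fin 2) ℂ)‖ ≤ 1 :=
    fun z r => mem_U1.1 (unitaryUnits_le_U1 (hol_mem_of hA _ _))
  have hv1 : ∀ x : Site (F.P K) l, ‖((vcov (F.P K).L U₀' (expCfg B') l (fun μ => ((x μ).val : ℤ)) : (Matrix (Fin 2) (Fin 2) ℂ)ˣ) : Matrix (Fin 2) (Fin 2) ℂ)‖ ≤ 1 :=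
    fun x => (mem_U1.1 (unitaryUnits_le_U1 (hVu _))).1
  have hv1' : ∀ x : Site (F.P K) l, ‖(((vcov (F.P K).L U₀' (expCfg B') l (fun μ => ((x μ).val : ℤ)))⁻¹ : (Matrix (Fin 2) (Fin 2) ℂ)ˣ) : Matrix (Fin 2) (Fin 2) ℂ)‖ ≤ 1 :=
    fun x => (mem_U1.1 (unitaryUnits_le_U1 (hVu _))).2
  have hv2 : ∀ x : Site (F.P K) l, ‖((vcov (F.P K).L U₀' (expCfg B') l (fun μ => ((x μ).val : ℤ)) : (Matrix (Fin 2) (Fin 2) ℂ)ˣ) : Matrix (Fin 2) (Fin 2) ℂ) - 1‖ ≤ 32 * ε₀ :=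
    fun x => (hV2 _).1
  -- the tree-ratio row by §1 at the box mass
  have hV₀bi : ∀ x κ, ‖((avgIter (F.P K).L U₀' l x κ : (Matrix (Fin 2) (Fin 2) ℂ)ˣ) : Matrix (Fin 2) (Fin 2) ℂ)‖ ≤ 1 ∧
      ‖(((avgIter (F.P K).L U₀' l x κ)⁻¹ : (Matrix (Fin 2) (Fin 2) ℂ)ˣ) : Matrix (Fin 2) (Fin 2) ℂ)‖ ≤ 1 := fun x κ => mem_U1.1 (unitaryUnits_le_U1 (hA x κ))
  have hR : ∀ (z : Site (F.P K) (l + 1)) (r : Fin (F.P K).d → Fin (F.P K).L),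
      ‖((tHol (avgIter (F.P K).L U₀' l) (tildIter (F.P K).L U₀' (expCfg B') l) (((F.P K).L : ℤ) • (fun μ => ((z μ).val : ℤ))) (treeWord (boxVec (F.P K).L r)) :
          (Matrix (Fin 2) (Fin 2) ℂ)ˣ) : Matrix (Fin 2) (Fin 2) ℂ) - 1‖ ≤ 6 * (F.L : ℝ) * Real.sqrt (Bl z) := by
    intro z r
    set zh : LSite (F.P K).d := fun μ => ((z μ).val : ℤ) with hzh
    set lo : LSite (F.P K).d := ((F.P K).L : ℤ) • zh with hlo
    set hi : LSite (F.P K).d := ((F.P K).L : ℤ) • zh + fun _ => (((F.P K).L : ℤ) - 1) with hhi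
    have hLpos : 0 < (F.P K).L := (F.P K).L_pos
    -- bonds with source in the box are box points `L•ẑ + boxVec r'`
    have hbox : ∀ x : LSite (F.P K).d, InBox lo hi x → ∃ r' : Fin (F.P K).d → Fin (F.P K).L, x = ((F.P K).L : ℤ) • zh + boxVec (F.P K).L r' := by
      intro x hx
      refine ⟨fun μ => ⟨(x μ - ((F.P K).L : ℤ) * zh μ).toNat, ?_⟩, ?_⟩
      · have h1 := (hx μ).1; have h2 := (hx μ).2
        simp only [hlo, hhi, Pi.smul_apply, Pi.add_apply, smul_eq_mul] at h1 h2
        omega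
      · funext μ
        have h1 := (hx μ).1; have h2 := (hx μ).2
        simp only [hlo, hhi, Pi.smul_apply, Pi.add_apply, smul_eq_mul] at h1 h2
        simp only [Pi.add_apply, Pi.smul_apply, smul_eq_mul, boxVec]
        rw [Int.toNat_of_nonneg (by omega)]
        ring
    have hs0 : 0 ≤ Real.sqrt (Bl z) := Real.sqrt_nonneg _
    have hV₁ : ∀ x κ, InBox lo hi x → InBox lo hi (x + e κ) →
        ‖((tildIter (F.P K).L U₀' (expCfg B') l x κ : (Matrix (Fin 2) (Fin 2) ℂ)ˣ) : Matrix (Fin 2) (Fin 2) ℂ) - 1‖ ≤ Real.sqrt (Bl z) ∧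
          ‖(((tildIter (F.P K).L U₀' (expCfg B') l x κ)⁻¹ : (Matrix (Fin 2) (Fin 2) ℂ)ˣ) : Matrix (Fin 2) (Fin 2) ℂ) - 1‖ ≤ Real.sqrt (Bl z) := by
      intro x κ hx _
      obtain ⟨r', hr'⟩ := hbox x hx
      have hle : ‖((tildIter (F.P K).L U₀' (expCfg B') l x κ : (Matrix (Fin 2) (Fin 2) ℂ)ˣ) : Matrix (Fin 2) (Fin 2) ℂ) - 1‖ ≤ Real.sqrt (Bl z) := by
        rw [← Real.sqrt_sq (norm_nonneg _)]
        refine Real.sqrt_le_sqrt ?_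
        rw [hBl]; dsimp only
        refine le_trans ?_ (Finset.single_le_sum (f := fun r'' : Fin (F.P K).d → Fin (F.P K).L => ∑ κ' : Fin (F.P K).d,
          ‖((tildIter (F.P K).L U₀' (expCfg B') l (((F.P K).L : ℤ) • zh + boxVec (F.P K).L r'') κ' : (Matrix (Fin 2) (Fin 2) ℂ)ˣ) : Matrix (Fin 2) (Fin 2) ℂ) - 1‖ ^ 2)
          (fun _ _ => Finset.sum_nonneg fun _ _ => sq_nonneg _) (Finset.mem_univ r'))
        rw [hr']
        exact Finset.single_le_sum (f := fun κ' : Fin (F.P K).d =>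
          ‖((tildIter (F.P K).L U₀' (expCfg B') l (((F.P K).L : ℤ) • zh + boxVec (F.P K).L r') κ' : (Matrix (Fin 2) (Fin 2) ℂ)ˣ) : Matrix (Fin 2) (Fin 2) ℂ) - 1‖ ^ 2)
          (fun _ _ => sq_nonneg _) (Finset.mem_univ κ)
      refine ⟨hle, (norm_inv_sub_one_le _ (mem_U1.1 (unitaryUnits_le_U1 (hTu x κ))).2).trans hle⟩
    have hp : InBox lo hi lo := fun μ => ⟨le_rfl, by
      simp only [hhi, hlo, Pi.add_apply, Pi.smul_apply, smul_eq_mul, le_add_iff_nonneg_right]; have := hLpos; omega⟩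
    have hpv : InBox lo hi (lo + boxVec (F.P K).L r) := fun μ => by
      have h0 : (0 : ℤ) ≤ boxVec (F.P K).L r μ := by simp [boxVec]
      have h1 : boxVec (F.P K).L r μ ≤ ((F.P K).L : ℤ) - 1 := by
        simp only [boxVec]; have := (r μ).isLt; omega
      simp only [hhi, hlo, Pi.add_apply, Pi.smul_apply, smul_eq_mul]
      exact ⟨by linarith, by linarith⟩
    -- length and smallness
    have hlen : ((treeWord (boxVec (F.P K).L r)).length : ℝ) ≤ 3 * (F.L : ℝ) := by
      rw [length_treeWord]
      have h := l1_boxVec_le (F.P K).L r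
      have h' : ((l1 (boxVec (F.P K).L r) : ℕ) : ℝ) ≤ (((F.P K).d : ℕ) : ℝ) * (((F.P K).L : ℕ) : ℝ) := by exact_mod_cast h
      have hd3r : (((F.P K).d : ℕ) : ℝ) = 3 := by exact_mod_cast hd3
      rw [hd3r, hPL] at h'
      exact h'
    have hn : ((treeWord (boxVec (F.P K).L r)).length : ℝ) * Real.sqrt (Bl z) ≤ 1 / 2 :=
      le_trans (mul_le_mul hlen (hsqrtBl z) hs0 (by positivity)) hw2
    have h := norm_tHol_treeWord_sub_one_le_of_box (avgIter (F.P K).L U₀' l) (tildIter (F.P K).L U₀' (expCfg B') l) hV₀bi hs0 hV₁ lo (boxVec (F.P K).L r) hp hpv hn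
    refine h.trans ?_
    nlinarith [mul_le_mul_of_nonneg_right hlen hs0]
  have hρB : ∀ z, 6 * (F.L : ℝ) * Real.sqrt (Bl z) ≤ 780 * (F.L : ℝ) ^ 3 * ε₀ := by
    intro z
    calc 6 * (F.L : ℝ) * Real.sqrt (Bl z) ≤ 6 * (F.L : ℝ) * (2 * (F.L : ℝ) ^ 2 * (65 * ε₀)) := mul_le_mul_of_nonneg_left (hsqrtBl z) (by positivity)
      _ = 780 * (F.L : ℝ) ^ 3 * ε₀ := by ring
  have ht : 780 * (F.L : ℝ) ^ 3 * ε₀ + 3 * (32 * ε₀) ≤ 1 / 4 := hw1.trans (by norm_num)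
  -- file F2
  have hstep := combFrameMass_step_le (P := F.P K) (𝔸 := Matrix (Fin 2) (Fin 2) ℂ) hlm U₀' (expCfg B') Bl (by positivity : (0 : ℝ) ≤ 6 * (F.L : ℝ)) hBl0
    (by positivity : (0 : ℝ) ≤ 32 * ε₀) (by positivity : (0 : ℝ) ≤ 780 * (F.L : ℝ) ^ 3 * ε₀) hU1hol hv1 hv1' hv2 hR hρB ht
  -- the source: `Σ_z Bl z = Mᶜ_l`
  have hsource : ∑ z : Site (F.P K) (l + 1), Bl z = ∑ x : Site (F.P K) l, ∑ κ : Fin (F.P K).d,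
      ‖((tildIter (F.P K).L U₀' (expCfg B') l (fun μ => ((x μ).val : ℤ)) κ : (Matrix (Fin 2) (Fin 2) ℂ)ˣ) : Matrix (Fin 2) (Fin 2) ℂ) - 1‖ ^ 2 := by
    rw [← sum_blockLift_eq (P := F.P K) hlm (fun x' => ∑ κ : Fin (F.P K).d,
      ‖((tildIter (F.P K).L U₀' (expCfg B') l x' κ : (Matrix (Fin 2) (Fin 2) ℂ)ˣ) : Matrix (Fin 2) (Fin 2) ℂ) - 1‖ ^ 2)]
    refine Finset.sum_congr rfl fun z _ => Finset.sum_congr rfl fun r' _ => ?_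
    rw [valLift_blockSite (P := F.P K) hlm z r']
  rw [hLd, hsource] at hstep
  have hM0 : 0 ≤ ∑ x : Site (F.P K) l, ∑ κ : Fin (F.P K).d,
      ‖((tildIter (F.P K).L U₀' (expCfg B') l (fun μ => ((x μ).val : ℤ)) κ : (Matrix (Fin 2) (Fin 2) ℂ)ˣ) : Matrix (Fin 2) (Fin 2) ℂ) - 1‖ ^ 2 :=
    Finset.sum_nonneg fun _ _ => Finset.sum_nonneg fun _ _ => sq_nonneg _
  refine hstep.trans (add_le_add le_rfl ?_)
  exact mul_le_mul_of_nonneg_right hw5 hM0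

/-! ## §4 ★★★ The comb accumulated-frame mass at the top, under `hMcomb` -/

/-- ★★★ **THE `ℓ²` MASS OF PRINT's COMB ACCUMULATED FRAMES AT THE MEMBER, UNDER THE DISPLAYED ROW `hMcomb`.**  Member `(F, n ≤ K)`, background `W ∈ 𝔘_k(ε₀)` (`RegPr F n K ε₀ W`,
`10⁷L⁴ε₀ ≤ 1`), bondwise Hermitian traceless `X` of (19)-size `nMax19 W X < ε₀∕6` (so `A := iX` is the E2E's letter `fun b ↦ I•X b`).  DISPLAYED: **`hMcomb`** — the single-bar `ℓ²` level
masses of PRINT's comb tower `Ũ₁ˡ = avgIter (e^{iX}W)♯ˡ·(avgIter W♯ˡ)⁻¹` over one period cell, `Σ_{z : Site (F.P K) l} Σ_κ ‖Ũ₁ˡ(ẑ, κ) − 1‖² ≤ Am·(Lˡ)⁻¹ + Bm·Lˡ` for `l < K − n`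
(«route-internal row (n3)-comb — NOT N06, NOT a print row; OPEN, XL, LOCATE #54»; ★★OWNER RULING №19 O4; free nonneg `Am Bm`, the assembler instantiates `Am := A·M₀`, `Bm := B·KD`).
CONCLUSION: `Σ_{y : Site (F.P n) 0} ‖↑(frameTw F n K h W (iX) y) − 1‖² ≤ 220L³·Am·(L^{K−n})⁻¹ + 110L²·Bm·L^{K−n}`, and the same for `‖↑(frameTw …)⁻¹ − 1‖²`
(§3 ∘ ✓ `frameMass_induction` ∘ `frameTw = vcov` re-indexed along `siteShift`).
[cite: Balaban1985Averaging, (82) p.30, (85)-(92) p.31, (97)-(99) p.32, (159)-(163) p.42; Balaban1985RegularSpaces, Prop. 7 (1.139)-(1.145) p.100; Balaban1985Variational, (19) p.281, (44) p.285] -/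
theorem sum_normSq_frameTw_sub_one_le_of_hMcomb {ε₀ : ℝ} (hε₀ : 0 < ε₀) (hε : 10 ^ 7 * (F.L : ℝ) ^ 4 * ε₀ ≤ 1)
    (W : GaugeField (F.P K) 0 (Matrix.specialUnitaryGroup (Fin 2) ℂ)) (hreg : RegPr F n K ε₀ W)
    (X : PBond (F.P K) 0 → Matrix (Fin 2) (Fin 2) ℂ) (hX : ∀ b, (X b).IsHermitian ∧ (X b).trace = 0) (hX6 : nMax19 F n K W X < ε₀ / 6)
    {Am Bm : ℝ} (hAm : 0 ≤ Am) (hBm : 0 ≤ Bm)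
    (hMcomb : ∀ l : ℕ, l < K - n →
      ∑ z : Site (F.P K) l, ∑ κ : Fin (F.P K).d,
        ‖((tildIter (F.P K).L (pull (bgUnits F K W) (basePt F n K)) (pull (fun b => expUnit (Complex.I • X b)) (basePt F n K)) l
              (fun μ => ((z μ).val : ℤ)) κ : (Matrix (Fin 2) (Fin 2) ℂ)ˣ) : Matrix (Fin 2) (Fin 2) ℂ) - 1‖ ^ 2
          ≤ Am * ((F.L : ℝ) ^ l)⁻¹ + Bm * (F.L : ℝ) ^ l) :
    (∑ y : Site (F.P n) 0, ‖((frameTw F n K h W (fun b => Complex.I • X b) y : (Matrix (Fin 2) (Fin 2) ℂ)ˣ) : Matrix (Fin 2) (Fin 2) ℂ) - 1‖ ^ 2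
        ≤ 220 * (F.L : ℝ) ^ 3 * Am * ((F.L : ℝ) ^ (K - n))⁻¹ + 110 * (F.L : ℝ) ^ 2 * Bm * (F.L : ℝ) ^ (K - n)) ∧
      (∑ y : Site (F.P n) 0, ‖(((frameTw F n K h W (fun b => Complex.I • X b) y)⁻¹ : (Matrix (Fin 2) (Fin 2) ℂ)ˣ) : Matrix (Fin 2) (Fin 2) ℂ) - 1‖ ^ 2
        ≤ 220 * (F.L : ℝ) ^ 3 * Am * ((F.L : ℝ) ^ (K - n))⁻¹ + 110 * (F.L : ℝ) ^ 2 * Bm * (F.L : ℝ) ^ (K - n)) := by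
  letI : CStarAlgebra (Matrix (Fin 2) (Fin 2) ℂ) := B10Eq29TubeLine.cstarAlgebraMatrix 2
  have hL3 : (3 : ℝ) ≤ F.L := by
    have h3 : 3 ≤ F.L := by obtain ⟨a, ha⟩ := F.hL.1; have := F.hL.2; omega
    exact_mod_cast h3
  have hL0 : (0 : ℝ) < F.L := by linarith
  have hε3 : 10 ^ 7 * (F.L : ℝ) ^ 3 * ε₀ ≤ 1 := by
    have h34 : (F.L : ℝ) ^ 3 ≤ (F.L : ℝ) ^ 4 := pow_le_pow_right₀ (by linarith) (by norm_num)
    nlinarith [h34, hε₀.le]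
  obtain ⟨hw1, -, -, hw4, -⟩ := member_windows F hε₀.le hε
  set U₀' := pull (bgUnits F K W) (basePt F n K) with hU₀'
  set B' : LSite (F.P K).d → Fin (F.P K).d → Matrix (Fin 2) (Fin 2) ℂ := fun z κ => Complex.I • X ⟨transl (basePt F n K) z, κ⟩ with hB'
  have hpull : pull (fun b => expUnit (Complex.I • X b)) (basePt F n K) = expCfg B' := pull_expUnit_eq_expCfg F (fun b => Complex.I • X b) (basePt F n K)
  -- the towers of masses
  set Φ : ℕ → ℝ := fun l => ∑ x : Site (F.P K) l, ‖((vcov (F.P K).L U₀' (expCfg B') l (fun μ => ((x μ).val : ℤ)) : (Matrix (Fin 2) (Fin 2) ℂ)ˣ) : Matrix (Fin 2) (Fin 2) ℂ) - 1‖ ^ 2 with hΦ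
  set M : ℕ → ℝ := fun l => if l < K - n then ∑ x : Site (F.P K) l, ∑ κ : Fin (F.P K).d,
    ‖((tildIter (F.P K).L U₀' (expCfg B') l (fun μ => ((x μ).val : ℤ)) κ : (Matrix (Fin 2) (Fin 2) ℂ)ˣ) : Matrix (Fin 2) (Fin 2) ℂ) - 1‖ ^ 2 else 0 with hM
  set q : ℝ := 3 * (((F.L : ℝ) ^ 3)⁻¹ + 144 * (780 * (F.L : ℝ) ^ 3 * ε₀ + 3 * (32 * ε₀)) ^ 2) with hq
  have hq0 : 0 ≤ q := by rw [hq]; positivity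
  have hΦ0 : Φ 0 = 0 := by
    rw [hΦ]; dsimp only
    refine Finset.sum_eq_zero fun x _ => ?_
    rw [vcov_zero, Units.val_one, sub_self, norm_zero]; ring
  have hΦs : ∀ l < K - n, Φ (l + 1) ≤ q * Φ l + 110 * (F.L : ℝ) ^ 2 * M l := by
    intro l hl
    have h := combFrameMass_recursion_of_regPr F hε₀ hε W hreg X hX hX6 hl
    rw [hM]; dsimp only; rw [if_pos hl]
    exact h
  have hMle : ∀ l ≤ K - n, M l ≤ Am * 1 * ((F.L : ℝ) ^ l)⁻¹ + Bm * (F.L : ℝ) ^ l := by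
    intro l hl
    rw [hM]; dsimp only
    by_cases hlt : l < K - n
    · rw [if_pos hlt, mul_one]
      have h := hMcomb l hlt
      rw [hpull] at h
      exact h
    · rw [if_neg hlt]; positivity
  have hind := frameMass_induction (L := (F.L : ℝ)) (q := q) (C := 110 * (F.L : ℝ) ^ 2) (A := Am) (B := Bm) (M₀ := 1) (by linarith) hq0
    (by rw [hq]; exact hw4) (by positivity) hAm hBm zero_le_one (K - n) Φ M hΦ0 hΦs hMle (K - n) le_rfl
  -- the top: `frameTw = vcov` re-indexed along `siteShift`
  have htop : ∑ y : Site (F.P n) 0, ‖((frameTw F n K h W (fun b => Complex.I • X b) y : (Matrix (Fin 2) (Fin 2) ℂ)ˣ) : Matrix (Fin 2) (Fin 2) ℂ) - 1‖ ^ 2 = Φ (K - n) := by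
    rw [hΦ]; dsimp only
    refine Fintype.sum_equiv (siteShift (sites_eq F n K h)) _ _ fun y => ?_
    rw [frameTw_eq_vcov]
    rfl
  have hbound : Φ (K - n) ≤ 220 * (F.L : ℝ) ^ 3 * Am * ((F.L : ℝ) ^ (K - n))⁻¹ + 110 * (F.L : ℝ) ^ 2 * Bm * (F.L : ℝ) ^ (K - n) := by
    refine hind.trans (le_of_eq ?_); ring
  refine ⟨htop ▸ hbound, le_trans (Finset.sum_le_sum fun y _ => ?_) (htop ▸ hbound)⟩
  -- `‖w⁻¹ − 1‖ ≤ ‖w − 1‖` (unitary frames)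
  have hy : frameTw F n K h W (fun b => Complex.I • X b) y ∈ unitaryUnits (Matrix (Fin 2) (Fin 2) ℂ) := by
    rw [frameTw_eq_vcov]
    exact (comb_level_rows_of_regPr F hε₀ hε3 W hreg X hX hX6 (K - n) le_rfl).2.2.1 _
  have h1 := norm_inv_sub_one_le _ (mem_U1.1 (unitaryUnits_le_U1 hy)).2
  exact pow_le_pow_left₀ (norm_nonneg _) h1 2

end Member

end Summit.QuantumFields.YangMills.Theorems.Prop7CombAccFrameMassOfRegPr

end
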